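import Literature.NumberTheory.LFunctions.DworkRationalityMeromorphyProofs
import Literature.NumberTheory.LFunctions.DworkRationalityTorusZeta
import HarnessLib

/-!
# `p`-adic meromorphy of Dwork's torus zeta function: the product formula (Koblitz, Ch. V §4, p. 134)

Part of the bottom-up proof of Dwork's rationality theorem
(`Literature/NumberTheory/LFunctions/DworkRationality.lean`); continuation of
`…/DworkRationalityMeromorphyProofs.lean` (see its module docstring for the overall argument).
This file performs step 3 there — exponentiating Koblitz's formula
`N'_s = ∑_{i=0}^{n} (-1)ⁱ C(n,i) q^{s(n-i-1)} + ∑_{i=0}^{n+1} (-1)ⁱ C(n+1,i) q^{s(n-i)} Tr(Ψˢ)`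
into `Z' = ∏ᵢ (1 - q^{n-i-1}T)^{(-1)^{i+1}C(n,i)} ∏ᵢ Δ(q^{n-i}T)^{(-1)^{i+1}C(n+1,i)}` — and
proves the assembly

* `Literature.NumberTheory.LFunctions.Dwork.torusZeta_isMeromorphic_of :
    dworkLifting → dworkFredholm → torusZeta_isMeromorphic`;
* `Literature.NumberTheory.LFunctions.Dwork.exists_polynomial_mul_zetaSeries_eq_of_lifting_of_fredholm :
    dworkLifting → dworkFredholm → pointCount_eq_sum_systemCount → exists_polynomial_mul_zetaSeries_eq`.

## References

* N. Koblitz, *p-adic Numbers, p-adic Analysis, and Zeta-Functions*, 2nd ed., GTM 58 (1984),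
  Ch. V §4, pp. 133–134. [Koblitz1984]
* B. Dwork, *On the rationality of the zeta function of an algebraic variety*, Amer. J. Math. 82
  (1960), 631–648, Thm. 1. [Dwork1960]
-/

open PowerSeries Filter Finset

noncomputable section

universe u

namespace Literature.NumberTheory.LFunctions

namespace Dwork

/-! ### Binomial bookkeeping (Koblitz, Ch. V §4, p. 133, last display) -/

section Binomial

variable {K : Type*} [Field K]

/-- `∑_{i even} g i - ∑_{i odd} g i = ∑ᵢ (-1)ⁱ g i`. [folklore] -/
theorem sum_even_sub_sum_odd (m : ℕ) (g : ℕ → K) :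
    ∑ i ∈ (range m).filter Even, g i - ∑ i ∈ (range m).filter Odd, g i =
      ∑ i ∈ range m, (-1 : K) ^ i * g i := by
  rw [← Finset.sum_filter_add_sum_filter_not (range m) Even, sub_eq_add_neg, ← Finset.sum_neg_distrib]
  have hfilter : (range m).filter (fun i => ¬Even i) = (range m).filter Odd :=
    Finset.filter_congr fun i _ => Nat.not_even_iff_odd
  rw [hfilter]
  refine congrArg₂ (· + ·) (Finset.sum_congr rfl fun i hi => ?_) (Finset.sum_congr rfl fun i hi => ?_)
  · rw [(Finset.mem_filter.mp hi).2.neg_one_pow, one_mul]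
  · rw [(Finset.mem_filter.mp hi).2.neg_one_pow, neg_one_mul]

/-- `∑_{i ≤ m} (-1)ⁱ C(m,i) (Q^{m-i}/Q)ˢ = Q^{-s} (Qˢ - 1)ᵐ` (binomial theorem). [folklore] -/
theorem sum_neg_one_pow_choose_mul (Q : K) (m s : ℕ) :
    ∑ i ∈ range (m + 1), (-1 : K) ^ i * ((m.choose i : K) * (Q ^ (m - i) * Q⁻¹) ^ s) =
      (Q ^ s)⁻¹ * (Q ^ s - 1) ^ m := by
  have h := add_pow (-1 : K) (Q ^ s) m
  rw [neg_add_eq_sub] at h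
  rw [h, Finset.mul_sum]
  refine Finset.sum_congr rfl fun i _ => ?_
  rw [mul_pow, inv_pow, show (Q ^ (m - i)) ^ s = (Q ^ s) ^ (m - i) by
    rw [← pow_mul, ← pow_mul, mul_comm]]
  ring

/-- **Koblitz's formula for `N'_s`** (Ch. V §4, p. 133, last display), in even/odd-split form:
if `Qˢ N = (Qˢ - 1)ⁿ + (Qˢ - 1)^{n+1} c` then
`N = (∑_{i even} - ∑_{i odd}) C(n,i) aᵢˢ + c · (∑_{i even} - ∑_{i odd}) C(n+1,i) bᵢˢ` with
`aᵢ = Q^{n-i}/Q`, `bᵢ = Q^{n+1-i}/Q`. [cite: Koblitz1984, Ch. V §4] -/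
theorem eq_binomial_sums {Q N c : K} (hQ : Q ≠ 0) {n s : ℕ}
    (h : Q ^ s * N = (Q ^ s - 1) ^ n + (Q ^ s - 1) ^ (n + 1) * c) :
    N = (∑ i ∈ (range (n + 1)).filter Even, (n.choose i : K) * (Q ^ (n - i) * Q⁻¹) ^ s -
          ∑ i ∈ (range (n + 1)).filter Odd, (n.choose i : K) * (Q ^ (n - i) * Q⁻¹) ^ s) +
        c * (∑ i ∈ (range (n + 1 + 1)).filter Even,
            ((n + 1).choose i : K) * (Q ^ (n + 1 - i) * Q⁻¹) ^ s -
          ∑ i ∈ (range (n + 1 + 1)).filter Odd,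
            ((n + 1).choose i : K) * (Q ^ (n + 1 - i) * Q⁻¹) ^ s) := by
  rw [sum_even_sub_sum_odd, sum_even_sub_sum_odd, sum_neg_one_pow_choose_mul Q n s,
    sum_neg_one_pow_choose_mul Q (n + 1) s]
  have hQs : Q ^ s ≠ 0 := pow_ne_zero _ hQ
  field_simp
  linear_combination h

end Binomial

/-! ### Step 3: exponentiation and the assembly -/

section Assembly

variable {p : ℕ} [Fact p.Prime]

/-- Coefficients of finite sums of multiples of power series. [folklore] -/
theorem coeff_sum_nsmul {ι : Type*} (t : Finset ι) (m : ι → ℕ) (F : ι → ℂ_[p]⟦X⟧) (j : ℕ) :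
    coeff j (∑ i ∈ t, m i • F i) = ∑ i ∈ t, (m i : ℂ_[p]) * coeff j (F i) := by
  rw [map_sum]
  exact Finset.sum_congr rfl fun i _ => by rw [map_nsmul, nsmul_eq_mul]

/-- Finite sums of multiples of series without constant term have no constant term. [folklore] -/
theorem constantCoeff_sum_nsmul {ι : Type*} (t : Finset ι) (m : ι → ℕ) (F : ι → ℂ_[p]⟦X⟧)
    (h : ∀ i ∈ t, constantCoeff (F i) = 0) : constantCoeff (∑ i ∈ t, m i • F i) = 0 := by
  rw [← coeff_zero_eq_constantCoeff_apply, coeff_sum_nsmul]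
  exact Finset.sum_eq_zero fun i hi => by rw [coeff_zero_eq_constantCoeff_apply, h i hi, mul_zero]

/-- **`p`-adic meromorphy of `Z'` from the two analytic inputs** (Koblitz, Ch. V §4, pp. 133–134;
see the module docstrings of this file and of `…/DworkRationalityMeromorphyProofs.lean`). [cite: Koblitz1984, Ch. V §4] -/
theorem torusZeta_isMeromorphic_of (h1 : dworkLifting.{u}) (h2 : dworkFredholm) :
    torusZeta_isMeromorphic.{u} := by
  intro k _ _ p _ _ σ _ f
  classical
  -- notation (plain `have`-free abbreviations are avoided: `q`, `n`, `Q` are `let`s only in comments)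
  have hq2 : 2 ≤ Nat.card k := one_lt_natCard
  have hQ0 : (Nat.card k : ℂ_[p]) ≠ 0 := by exact_mod_cast (show Nat.card k ≠ 0 by omega)
  -- the two analytic inputs
  obtain ⟨G, hG, hlift⟩ := h1 k p σ f
  obtain ⟨Δ, hΔent, hΔ0, hΔ⟩ := h2 p (Option σ) (Nat.card k) hq2 G hG
  set TL := traceLogSeries p (Nat.card k) G with hTL
  have hTL0 : constantCoeff TL = 0 := constantCoeff_traceLogSeries p (Nat.card k) G
  -- Steps 1–2: `Qˢ N'_s = (Qˢ-1)ⁿ + (Qˢ-1)^{n+1} Tr(Ψˢ)` for `s ≥ 1`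
  have hcount : ∀ s : ℕ, 0 < s → (Nat.card k : ℂ_[p]) ^ s * (torusCount k f s : ℂ_[p]) =
      ((Nat.card k : ℂ_[p]) ^ s - 1) ^ Fintype.card σ + ((Nat.card k : ℂ_[p]) ^ s - 1) ^ (Fintype.card σ + 1) * traceNumber p (Nat.card k) G s := by
    intro s hs
    haveI : NeZero s := ⟨hs.ne'⟩
    obtain ⟨τ, ψ, hτ, hτpow, hτsurj, hψ, hid⟩ := hlift s
    have hc := card_pow_mul_torusCount_eq (p := p) f s G τ ψ hτ hτpow hτsurj hψ hid
    have hcast : ((Nat.card k ^ s - 1 : ℕ) : ℂ_[p]) = (Nat.card k : ℂ_[p]) ^ s - 1 := by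
      rw [Nat.cast_sub (Nat.one_le_pow _ _ (by omega)), Nat.cast_pow, Nat.cast_one]
    rw [Nat.cast_pow, hcast] at hc
    exact hc
  -- Koblitz's formula for `N'_s` in even/odd-split form
  have hformula : ∀ s : ℕ, 0 < s → (torusCount k f s : ℂ_[p]) =
      (∑ i ∈ ((range (Fintype.card σ + 1)).filter Even), ((Fintype.card σ).choose i : ℂ_[p]) * ((Nat.card k : ℂ_[p]) ^ (Fintype.card σ - i) * (Nat.card k : ℂ_[p])⁻¹) ^ s - ∑ i ∈ ((range (Fintype.card σ + 1)).filter Odd), ((Fintype.card σ).choose i : ℂ_[p]) * ((Nat.card k : ℂ_[p]) ^ (Fintype.card σ - i) * (Nat.card k : ℂ_[p])⁻¹) ^ s) +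
        traceNumber p (Nat.card k) G s *
          (∑ i ∈ ((range (Fintype.card σ + 1 + 1)).filter Even), ((Fintype.card σ + 1).choose i : ℂ_[p]) * ((Nat.card k : ℂ_[p]) ^ (Fintype.card σ + 1 - i) * (Nat.card k : ℂ_[p])⁻¹) ^ s -
            ∑ i ∈ ((range (Fintype.card σ + 1 + 1)).filter Odd), ((Fintype.card σ + 1).choose i : ℂ_[p]) * ((Nat.card k : ℂ_[p]) ^ (Fintype.card σ + 1 - i) * (Nat.card k : ℂ_[p])⁻¹) ^ s) :=
    fun s hs => eq_binomial_sums hQ0 (hcount s hs)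
  -- the logarithmic series: `log Z' = P - Nn`
  set P : ℂ_[p]⟦X⟧ := ∑ i ∈ ((range (Fintype.card σ + 1)).filter Even), (Fintype.card σ).choose i • logGeom ((Nat.card k : ℂ_[p]) ^ (Fintype.card σ - i) * (Nat.card k : ℂ_[p])⁻¹) +
    ∑ i ∈ ((range (Fintype.card σ + 1 + 1)).filter Even), (Fintype.card σ + 1).choose i • rescale ((Nat.card k : ℂ_[p]) ^ (Fintype.card σ + 1 - i) * (Nat.card k : ℂ_[p])⁻¹) TL with hP
  set Nn : ℂ_[p]⟦X⟧ := ∑ i ∈ ((range (Fintype.card σ + 1)).filter Odd), (Fintype.card σ).choose i • logGeom ((Nat.card k : ℂ_[p]) ^ (Fintype.card σ - i) * (Nat.card k : ℂ_[p])⁻¹) +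
    ∑ i ∈ ((range (Fintype.card σ + 1 + 1)).filter Odd), (Fintype.card σ + 1).choose i • rescale ((Nat.card k : ℂ_[p]) ^ (Fintype.card σ + 1 - i) * (Nat.card k : ℂ_[p])⁻¹) TL with hNn
  set Lp : ℂ_[p]⟦X⟧ := PowerSeries.mk fun s => if s = 0 then 0 else
    (s : ℂ_[p])⁻¹ * (torusCount k f s : ℂ_[p]) with hLp
  have hcoeffTL : ∀ (c : ℂ_[p]) (s : ℕ), coeff s (rescale c TL) =
      if s = 0 then 0 else c ^ s * ((s : ℂ_[p])⁻¹ * traceNumber p (Nat.card k) G s) := by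
    intro c s
    rw [coeff_rescale, hTL, traceLogSeries, coeff_mk]
    split_ifs <;> simp
  have hcoeffLG : ∀ (c : ℂ_[p]) (s : ℕ), coeff s (logGeom c) =
      if s = 0 then 0 else (s : ℂ_[p])⁻¹ * c ^ s := by
    intro c s
    rw [coeff_logGeom]
    split_ifs
    · rfl
    · rw [map_inv₀, map_natCast]
  have hLPN : Lp = P - Nn := by
    ext s
    rw [hLp, coeff_mk, map_sub, hP, hNn, map_add, map_add, coeff_sum_nsmul, coeff_sum_nsmul,
      coeff_sum_nsmul, coeff_sum_nsmul]
    simp_rw [hcoeffTL, hcoeffLG]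
    by_cases hs : s = 0
    · simp [hs]
    · simp_rw [if_neg hs]
      have e1 : ∀ (t : Finset ℕ) (C g : ℕ → ℂ_[p]),
          ∑ i ∈ t, C i * ((s : ℂ_[p])⁻¹ * g i) = (s : ℂ_[p])⁻¹ * ∑ i ∈ t, C i * g i := by
        intro t C g
        rw [Finset.mul_sum]
        exact Finset.sum_congr rfl fun i _ => by ring
      have e2 : ∀ (t : Finset ℕ) (C g : ℕ → ℂ_[p]) (c : ℂ_[p]),
          ∑ i ∈ t, C i * (g i * ((s : ℂ_[p])⁻¹ * c)) = (s : ℂ_[p])⁻¹ * c * ∑ i ∈ t, C i * g i := by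
        intro t C g c
        rw [Finset.mul_sum]
        exact Finset.sum_congr rfl fun i _ => by ring
      rw [e1, e1, e2, e2, hformula s (Nat.pos_of_ne_zero hs)]
      ring
  have hP0 : constantCoeff P = 0 := by
    rw [hP, map_add, constantCoeff_sum_nsmul _ _ _ fun i _ => constantCoeff_logGeom _,
      constantCoeff_sum_nsmul _ _ _ fun i _ => ?_, add_zero]
    rw [← coeff_zero_eq_constantCoeff_apply, hcoeffTL, if_pos rfl]
  have hNn0 : constantCoeff Nn = 0 := by
    rw [hNn, map_add, constantCoeff_sum_nsmul _ _ _ fun i _ => constantCoeff_logGeom _,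
      constantCoeff_sum_nsmul _ _ _ fun i _ => ?_, add_zero]
    rw [← coeff_zero_eq_constantCoeff_apply, hcoeffTL, if_pos rfl]
  have hLp0 : constantCoeff Lp = 0 := by
    rw [← coeff_zero_eq_constantCoeff_apply, hLp, coeff_mk, if_pos rfl]
  -- `exp(-TL) = Δ`, hence `exp(-(TL(cT))) = Δ(cT)`
  have hexpTL : ∀ c : ℂ_[p], (exp ℂ_[p]).subst (-rescale c TL) = rescale c Δ := by
    intro c
    rw [← exp_subst_neg_eq_of_mul hTL0 hΔ, rescale_exp_subst c (by rw [map_neg, hTL0, neg_zero]),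
      map_neg]
  -- the entire functions `B = exp(-P)` and `A = exp(-Nn)`
  have hexp_neg : ∀ (t₁ t₂ : Finset ℕ),
      (exp ℂ_[p]).subst (-(∑ i ∈ t₁, (Fintype.card σ).choose i • logGeom ((Nat.card k : ℂ_[p]) ^ (Fintype.card σ - i) * (Nat.card k : ℂ_[p])⁻¹) +
        ∑ i ∈ t₂, (Fintype.card σ + 1).choose i • rescale ((Nat.card k : ℂ_[p]) ^ (Fintype.card σ + 1 - i) * (Nat.card k : ℂ_[p])⁻¹) TL)) =
      (∏ i ∈ t₁, (1 - C ((Nat.card k : ℂ_[p]) ^ (Fintype.card σ - i) * (Nat.card k : ℂ_[p])⁻¹) * X) ^ (Fintype.card σ).choose i) *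
        ∏ i ∈ t₂, (rescale ((Nat.card k : ℂ_[p]) ^ (Fintype.card σ + 1 - i) * (Nat.card k : ℂ_[p])⁻¹) Δ) ^ (Fintype.card σ + 1).choose i := by
    intro t₁ t₂
    have e1 : -(∑ i ∈ t₁, (Fintype.card σ).choose i • logGeom ((Nat.card k : ℂ_[p]) ^ (Fintype.card σ - i) * (Nat.card k : ℂ_[p])⁻¹) + ∑ i ∈ t₂, (Fintype.card σ + 1).choose i • rescale ((Nat.card k : ℂ_[p]) ^ (Fintype.card σ + 1 - i) * (Nat.card k : ℂ_[p])⁻¹) TL) =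
        ∑ i ∈ t₁, (Fintype.card σ).choose i • (-logGeom ((Nat.card k : ℂ_[p]) ^ (Fintype.card σ - i) * (Nat.card k : ℂ_[p])⁻¹)) + ∑ i ∈ t₂, (Fintype.card σ + 1).choose i • (-rescale ((Nat.card k : ℂ_[p]) ^ (Fintype.card σ + 1 - i) * (Nat.card k : ℂ_[p])⁻¹) TL) := by
      rw [neg_add, ← Finset.sum_neg_distrib, ← Finset.sum_neg_distrib]
      simp_rw [smul_neg]
    rw [e1, Literature.AlgebraicGeometry.Motives.FrobeniusTrace.exp_subst_add
      (constantCoeff_sum_nsmul _ _ _ fun i _ => by rw [map_neg, constantCoeff_logGeom, neg_zero])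
      (constantCoeff_sum_nsmul _ _ _ fun i _ => by
        rw [map_neg, ← coeff_zero_eq_constantCoeff_apply, hcoeffTL, if_pos rfl, neg_zero])]
    congr 1
    · refine (exp_subst_sum_nsmul t₁ _ _ fun i _ => ?_).trans ?_
      · rw [map_neg, constantCoeff_logGeom, neg_zero]
      · exact Finset.prod_congr rfl fun i _ => by rw [exp_subst_neg_logGeom]
    · refine (exp_subst_sum_nsmul t₂ _ _ fun i _ => ?_).trans ?_
      · rw [map_neg, ← coeff_zero_eq_constantCoeff_apply, hcoeffTL, if_pos rfl, neg_zero]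
      · exact Finset.prod_congr rfl fun i _ => by rw [hexpTL]
  have hent : ∀ (t₁ t₂ : Finset ℕ), IsEntire p ((∏ i ∈ t₁, (1 - C ((Nat.card k : ℂ_[p]) ^ (Fintype.card σ - i) * (Nat.card k : ℂ_[p])⁻¹) * X) ^ (Fintype.card σ).choose i) *
      ∏ i ∈ t₂, (rescale ((Nat.card k : ℂ_[p]) ^ (Fintype.card σ + 1 - i) * (Nat.card k : ℂ_[p])⁻¹) Δ) ^ (Fintype.card σ + 1).choose i) := fun t₁ t₂ =>
    (IsEntire.prod t₁ fun i _ => (isEntire_one_sub_C_mul_X ((Nat.card k : ℂ_[p]) ^ (Fintype.card σ - i) * (Nat.card k : ℂ_[p])⁻¹)).pow _).mul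
      (IsEntire.prod t₂ fun i _ => (hΔent.rescale ((Nat.card k : ℂ_[p]) ^ (Fintype.card σ + 1 - i) * (Nat.card k : ℂ_[p])⁻¹)).pow _)
  -- `Z' ↦ ℂ_p⟦T⟧` is `exp(Lp)`
  have hZ : (countZeta fun s => (torusCount k f s : ℤ)).map (algebraMap ℚ ℂ_[p]) =
      (exp ℂ_[p]).subst Lp := by
    rw [countZeta, map_exp_subst (algebraMap ℚ ℂ_[p]) (fun x => by rw [Algebra.algebraMap_self,
      RingHom.id_apply]) (constantCoeff_countLogSeries _)]
    congr 1
    ext s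
    rw [coeff_map, coeff_countLogSeries, hLp, coeff_mk]
    split_ifs with hs
    · rw [map_zero]
    · rw [map_div₀, map_natCast, map_intCast, Int.cast_natCast, div_eq_inv_mul]
  -- conclusion
  refine ⟨(∏ i ∈ ((range (Fintype.card σ + 1)).filter Odd), (1 - C ((Nat.card k : ℂ_[p]) ^ (Fintype.card σ - i) * (Nat.card k : ℂ_[p])⁻¹) * X) ^ (Fintype.card σ).choose i) * ∏ i ∈ ((range (Fintype.card σ + 1 + 1)).filter Odd), (rescale ((Nat.card k : ℂ_[p]) ^ (Fintype.card σ + 1 - i) * (Nat.card k : ℂ_[p])⁻¹) Δ) ^ (Fintype.card σ + 1).choose i,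
    (∏ i ∈ ((range (Fintype.card σ + 1)).filter Even), (1 - C ((Nat.card k : ℂ_[p]) ^ (Fintype.card σ - i) * (Nat.card k : ℂ_[p])⁻¹) * X) ^ (Fintype.card σ).choose i) * ∏ i ∈ ((range (Fintype.card σ + 1 + 1)).filter Even), (rescale ((Nat.card k : ℂ_[p]) ^ (Fintype.card σ + 1 - i) * (Nat.card k : ℂ_[p])⁻¹) Δ) ^ (Fintype.card σ + 1).choose i,
    hent ((range (Fintype.card σ + 1)).filter Odd) ((range (Fintype.card σ + 1 + 1)).filter Odd), hent ((range (Fintype.card σ + 1)).filter Even) ((range (Fintype.card σ + 1 + 1)).filter Even), ?_, ?_⟩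
  · rw [← hexp_neg ((range (Fintype.card σ + 1)).filter Even) ((range (Fintype.card σ + 1 + 1)).filter Even), ← hP]
    intro h0
    have h1 := Literature.AlgebraicGeometry.Motives.FrobeniusTrace.constantCoeff_exp_subst
      (R := ℂ_[p]) (f := -P) (by rw [map_neg, hP0, neg_zero])
    rw [h0, map_zero] at h1
    exact zero_ne_one h1
  · rw [hZ, ← hexp_neg ((range (Fintype.card σ + 1)).filter Even) ((range (Fintype.card σ + 1 + 1)).filter Even), ← hexp_neg ((range (Fintype.card σ + 1)).filter Odd) ((range (Fintype.card σ + 1 + 1)).filter Odd), ← hP, ← hNn,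
      ← Literature.AlgebraicGeometry.Motives.FrobeniusTrace.exp_subst_add hLp0
        (by rw [map_neg, hP0, neg_zero])]
    congr 1
    rw [hLPN]
    ring

variable {k : Type u} [Field k] [Finite k]

/-- **Dwork's rationality theorem from the three remaining named facts**: the `p`-adic lifting
of the character sum (`dworkLifting`, Koblitz V.2/V.4), the Fredholm determinant of Dwork's
operator (`dworkFredholm`, Koblitz V.3) and the reduction of point counts of finite-type
`k`-schemes to affine counts (`pointCount_eq_sum_systemCount`) imply
`Literature.NumberTheory.LFunctions.exists_polynomial_mul_zetaSeries_eq` (Dwork 1960, Thm. 1).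
[cite: Dwork1960, Thm. 1] -/
theorem exists_polynomial_mul_zetaSeries_eq_of_lifting_of_fredholm (h1 : dworkLifting.{u})
    (h2 : dworkFredholm) (h3 : pointCount_eq_sum_systemCount.{u}) :
    LFunctions.exists_polynomial_mul_zetaSeries_eq (k := k) :=
  exists_polynomial_mul_zetaSeries_eq_of_isMeromorphic (torusZeta_isMeromorphic_of h1 h2) h3

end Assembly

end Dwork

end Literature.NumberTheory.LFunctions
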